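import Summits.AtomisticToContinuum.Crystallization.Theses.EnergyDerivativeOrder

/-!
# Route `EnergyDerivativeOrder`, item stmt-AtomisticToContinuum-14179 `CruxesToTarget`

Glue of route `AtomisticToContinuum/Crystallization/EnergyDerivativeOrder`:

`DirectionalRobustHcpBound → NondegenerateHcpOptimum → TrialUpperBound → DanskinStep →
SupergradientSandwich → Target`.

Pure logic: `DanskinStep` applied to (`DirectionalRobustHcpBound`, `NondegenerateHcpOptimum`,
`TrialUpperBound`) yields one relaxed hcp crystal `hcpPeriodicConfiguration ha hh` with `0 < a`,
`|h/a - √(2/3)| ≤ 1/400`, the energetic conjunct (i') (`IsLeast` among periodic configurations and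
`E(N)/N → e(hcp(a,h))`) and the two one-sided no-corner clauses along every `C²` compactly supported
`W`; `SupergradientSandwich` at `P := hcpPeriodicConfiguration ha hh` turns the no-corner clauses
into (ii') (pair statistics of every sequence of Lennard-Jones ground states converge to those of
`hcp(a,h)`).  The resulting tuple is `Target` verbatim.
-/

namespace Summit.AtomisticToContinuum.Crystallization.Theorems

/-- **Item stmt-AtomisticToContinuum-14179** (`CruxesToTarget`, route `EnergyDerivativeOrder`):
`DirectionalRobustHcpBound → NondegenerateHcpOptimum → TrialUpperBound → DanskinStep →
SupergradientSandwich → Target`.  `DanskinStep` on the first three hypotheses produces the relaxed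
hcp crystal with (i') and no corner of the ground-state energy along every `C²` bump;
`SupergradientSandwich` at that crystal gives (ii'). -/
theorem energyDerivativeOrder_cruxesToTarget_proof :
    Summit.AtomisticToContinuum.Crystallization.Theses.EnergyDerivativeOrder.CruxesToTarget := by
  unfold Summit.AtomisticToContinuum.Crystallization.Theses.EnergyDerivativeOrder.CruxesToTarget
  intro hC1 hC3 hTrial hDanskin hSandwich
  obtain ⟨a, h, ha, hh, ha0, hwin, hleast, hlim, hnocorner⟩ := hDanskin hC1 hC3 hTrial
  exact ⟨a, h, ha, hh, ha0, hwin, hleast, hlim,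
    hSandwich (Literature.MathematicalPhysics.StatisticalMechanics.hcpPeriodicConfiguration ha hh)
      hnocorner⟩

end Summit.AtomisticToContinuum.Crystallization.Theorems
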